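import Summits.BirchSwinnertonDyer.BirchSwinnertonDyer.Theorems.ByReductionTypeAtTwoAdditivePotGoodPrintFamily37a1
import Summits.BirchSwinnertonDyer.BirchSwinnertonDyer.Theorems.SignedLowerHalvesKobayashiLowerHalfLargeImageBSTWTwistAuxWitness
import Summits.BirchSwinnertonDyer.Rank1Residual.EisensteinPrimes
import HarnessLib

/-!
# K4 crux `AdditiveRankZeroAtTwo` (19098), child C3″ `AdditivePotGoodLowerHalfAtTwo` (22617): the GENERAL transport
# «exact `2`-adic valuation of a twisted central `L`-value ⇒ the LOWER half of BSD₂ at the twist» for the twists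
# `V^{(D)}`, `D ≡ 3 (mod 4)` square-free, of a curve `V` GOOD at `2` — the additive, potentially good twists

Cell `bsd-2adic`, seat `bsd-2adic-k4-w2` GEN 5 (prover, explicit unit, no kit); `--supports stmt-BirchSwinnertonDyer-22617
--as helper`. HONEST FRAMING (D-0036/D-0054): kernel theorems; the only named facts are the cell's standard PRINT binders
`hasEntireLFunction_rat` (modularity) and `rank_eq_analyticRank_of_analyticRank_le_one` (GZK) in §7; the consumer
`…PrintTwistLowerHalfANS.lean` feeds §7 with Adachi–Nomoto–Shii 2026 Thms. 4.3/4.4 BY NAME. Generalises the `37a1`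
files (`…PrintFamily37a1{Model,}.lean`) from one base curve to EVERY base curve good at `2` with `E[2]` irreducible.
Closes nothing at the `∀`-level; nothing booked; BSD is not proved by any of this.

CONTENTS (0 `def`, 0 `sorry`).
* §1–§2 TOOLS (Silverman VII.1): from an INTEGRAL equation to a MINIMAL one the scaling `u` is integral
  (`valuation_u_le_one_of_isIntegral_of_isMinimal_smul`, from Mathlib's `IsMinimal` = maximality of `v(Δ)` among
  integral models); globally over `ℚ`: `u ∈ ℤ ∖ {0}` (`exists_int_eq_u_of_isIntegralAt_of_isGloballyMinimal_smul`).
  (The both-minimal case `u = ±1` is the tree's `isGloballyMinimal_unique_holds`; the `37a1` file's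
  `u_eq_one_or_neg_one_of_isGloballyMinimal_smul` is a re-derivation of that special case.)
* §3 the INTEGRAL model `Y_D(V) = [0, D b₂, 0, 8D² b₄, 16D³ b₆] = C_{1/2} • V^{(D)}` of the tree's (non-`2`-integral) twist.
* §4 Pal's unit: for EVERY global minimal model `W = C • V^{(D)}`, `|u(C)| = n/2` with `n ∈ ℤ ∖ {0}`
  (`exists_abs_u_eq_half_int`) — so `ord₂ ũ ≥ −1`, the only input the lower half needs (Pal 2012 Prop. 2.5 computes `ũ`
  exactly; not needed).
* §5 `Ω(W)·√|D| = (|n|/2)·c_∞(V)·Ω^{sgn D}(V)` (`realPeriodRat_twist_mul_sqrt`: Pal 2012 Thm. 3.2 both signs — tree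
  `realPeriodRat_mul_sqrt_of_twist_of_neg/_of_pos` — with `c_∞(W) = c_∞(V)` and `Ω(V) = c_∞(V)·Ω⁺(V)`; `Ω^{sgn}` is the
  Adachi–Nomoto–Shii period `periodSgn`).
* §6 HABITAT: `V` good at `2` with `ord₂ j ≥ 0`, non-CM, `E[2]` irreducible, `D ≡ 3 (mod 4)` square-free ⇒ every global minimal
  `W ≅ V^{(D)}` is ADDITIVE at `2` (not good: Barrios et al. 2025 Thm. 5.1 through the tree's
  `X7Twist.not_hasGoodReductionAtPrime_two_of_twist_of_ramifiedInQuadratic`; not multiplicative: `ord₂ j ≥ 0`),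
  POTENTIALLY GOOD, NON-CM, `E[2]` IRREDUCIBLE (`habitat_smul_twist_of_good_two`).
* §7 CORE `missingLowerBoundAt_two_of_twist_algPart`: if `L(W,1) = x·Ω^{sgn D}(V)/√(4|D|)` (ANS's `IsAlgPart V W D x`) with
  `x ≠ 0` and `ord₂ x ≤ [Δ(V) > 0]`, then `r_an(W) = 0` and `MissingLowerBoundAt W 2`: `L(W,1)/Ω(W) = x/(|n|·c_∞(V))`,
  `Reg = 1` (GZK), `#W(ℚ)_tors` odd (Mazur), so `#Ш_an(W) = x·#tors²/(|n|·c_∞(V)·Tam(W))` has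
  `ord₂ ≤ ord₂ x − ord₂ c_∞(V) ≤ 0 ≤ ord₂ #Ш(W)`.

References: [AdachiNomotoShii2026] Thm. 2.1, Thms. 4.3/4.4 (the currency `IsAlgPart`, `periodSgn`); [Pal2012] Prop. 2.5,
Thm. 3.2; [BarriosEtAl2025] Thm. 5.1; [SilvermanAEC2009] VII.1 Prop. 1.3, VII.5 Prop. 5.1, VIII.8; [Mazur1978] (torsion vs.
irreducibility); [Miller2011LMS] Def. 1.1.
-/

set_option autoImplicit false
set_option linter.dupNamespace false

noncomputable section

open scoped Classical

open IsDedekindDomain IsDiscreteValuationRing IsLocalRing NumberField Rat.HeightOneSpectrum WeierstrassCurve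
  Literature.NumberTheory.EllipticCurves
  Literature.NumberTheory.DiophantineGeometry
  Literature.NumberTheory.EllipticCurves.Rank1Residual
  Literature.NumberTheory.EllipticCurves.Rank1Residual.Typed
  Literature.NumberTheory.EllipticCurves.AdachiNomotoShii2026
  Literature.NumberTheory.EllipticCurves.ModularForms
  Literature.NumberTheory.EllipticCurves.CoatesLiTianZhai2015
  Literature.NumberTheory.EllipticCurves.BurungaleSkinnerTianWan2024
  Summit.BirchSwinnertonDyer.Rank1Residual
  Summit.BirchSwinnertonDyer.Rank1Residual.X5.O1
  Summit.BirchSwinnertonDyer.Rank1Residual.AdditivePotMult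
  Summit.BirchSwinnertonDyer.Rank1Residual.P2
  Summit.BirchSwinnertonDyer.BirchSwinnertonDyer.Theorems

namespace Summit.BirchSwinnertonDyer.BirchSwinnertonDyer.Theorems.AddPotGoodPrint

/-! ## §1 Local: from an INTEGRAL equation to a MINIMAL one the scaling `u` is integral -/

/-- **From an integral equation to a minimal one, `u` is integral** (Silverman VII.1: for `Y` integral over the DVR `R`
and `E • Y` minimal, `v(Δ(Y)) ≥ v(Δ(E • Y))`, i.e. `v(u(E)) ≥ 0`; here in Mathlib's multiplicative normalisation
`valuation(u) ≤ 1`, read off `IsMinimal` = `MaximalFor` of the discriminant valuation among integral models).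
[cite: SilvermanAEC2009, VII.1 Prop. 1.3 and the definition of a minimal equation] -/
theorem valuation_u_le_one_of_isIntegral_of_isMinimal_smul (R : Type*) [CommRing R] [IsDomain R]
    [IsDiscreteValuationRing R] {K : Type*} [Field K] [Algebra R K] [IsFractionRing R K]
    (Y : WeierstrassCurve K) [hY : IsIntegral R Y] (E : VariableChange K) [hM : IsMinimal R (E • Y)]
    (hΔ : Y.Δ ≠ 0) : (IsDiscreteValuationRing.maximalIdeal R).valuation K (E.u : K) ≤ 1 := by
  -- minimality of `E • Y` among the integral equations isomorphic to it, tested at `E⁻¹ • (E • Y) = Y`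
  have h2 := hM.val_Δ_maximal.2 (j := E⁻¹) (by simpa [smul_smul] using hY)
  have hle : valuation_Δ_aux R (E⁻¹ • (E • Y)) ≤ valuation_Δ_aux R ((1 : VariableChange K) • (E • Y)) := by
    rcases le_total (valuation_Δ_aux R ((1 : VariableChange K) • (E • Y))) (valuation_Δ_aux R (E⁻¹ • (E • Y)))
      with h | h
    · exact h2 h
    · exact h
  simp only [inv_smul_smul, one_smul] at hle
  have hle' : (IsDiscreteValuationRing.maximalIdeal R).valuation K Y.Δ ≤ (IsDiscreteValuationRing.maximalIdeal R).valuation K (E • Y).Δ := by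
    have := hle
    rw [← Subtype.coe_le_coe, valuation_Δ_aux_eq_of_isIntegral, valuation_Δ_aux_eq_of_isIntegral] at this
    exact this
  rw [variableChange_Δ, map_mul, map_pow, Units.val_inv_eq_inv_val, map_inv₀] at hle'
  have hΔ' : 0 < (IsDiscreteValuationRing.maximalIdeal R).valuation K Y.Δ := by
    rw [Valuation.pos_iff]; exact hΔ
  by_contra hgt
  rw [not_le] at hgt
  have hinv : ((IsDiscreteValuationRing.maximalIdeal R).valuation K (E.u : K))⁻¹ < 1 := inv_lt_one_of_one_lt₀ hgt
  have hpow : ((IsDiscreteValuationRing.maximalIdeal R).valuation K (E.u : K))⁻¹ ^ 12 < 1 := pow_lt_one₀ zero_le hinv (by norm_num)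
  have := mul_lt_mul_of_pos_right hpow hΔ'
  rw [one_mul] at this
  exact absurd hle' (not_le.mpr this)

/-! ## §2 Global: an integral equation over `ℚ` and a global minimal model differ by `u ∈ ℤ ∖ {0}` -/

/-- **Over `ℚ`: an equation integral at every place and a global minimal model differ by `u ∈ ℤ ∖ {0}`** (the previous
lemma at every finite place, then `𝓞_ℚ = ⋂_v 𝓞_v`). [cite: SilvermanAEC2009, VII.1 Prop. 1.3 and VIII.8] -/
theorem exists_int_eq_u_of_isIntegralAt_of_isGloballyMinimal_smul {Y W : WeierstrassCurve ℚ}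
    (hΔ : Y.Δ ≠ 0) (hY : ∀ v : HeightOneSpectrum (𝓞 ℚ), Y.IsIntegralAt v) [W.IsGloballyMinimal]
    (E : VariableChange ℚ) (hE : E • Y = W) : ∃ n : ℤ, n ≠ 0 ∧ (E.u : ℚ) = n := by
  have hall : ∀ v : HeightOneSpectrum (𝓞 ℚ), v.valuation ℚ (E.u : ℚ) ≤ 1 := by
    intro v
    haveI : (Y.baseChange (v.adicCompletion ℚ)).IsIntegral (v.adicCompletionIntegers ℚ) := hY v
    have hbc : (E.map (algebraMap ℚ (v.adicCompletion ℚ))) • Y.baseChange (v.adicCompletion ℚ) =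
        W.baseChange (v.adicCompletion ℚ) := by
      rw [WeierstrassCurve.baseChange, WeierstrassCurve.baseChange, WeierstrassCurve.map_variableChange, hE]
    haveI : ((E.map (algebraMap ℚ (v.adicCompletion ℚ))) • Y.baseChange (v.adicCompletion ℚ)).IsMinimal
        (v.adicCompletionIntegers ℚ) := by
      rw [hbc]; exact IsGloballyMinimal.isMinimal v
    have hΔv : (Y.baseChange (v.adicCompletion ℚ)).Δ ≠ 0 := by
      rw [WeierstrassCurve.baseChange, WeierstrassCurve.map_Δ]; exact (map_ne_zero _).mpr hΔ
    have h := valuation_u_le_one_of_isIntegral_of_isMinimal_smul (v.adicCompletionIntegers ℚ)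
      (Y.baseChange (v.adicCompletion ℚ)) (E.map (algebraMap ℚ (v.adicCompletion ℚ))) hΔv
    obtain ⟨a, ha⟩ := exists_lift_of_le_one h
    have hmem := a.2
    rw [HeightOneSpectrum.mem_adicCompletionIntegers, ← ValuationSubring.algebraMap_apply, ha] at hmem
    change Valued.v ((algebraMap ℚ (v.adicCompletion ℚ)) (E.u : ℚ)) ≤ 1 at hmem
    rwa [valued_algebraMap_adicCompletion] at hmem
  have hu : (E.u : ℚ) ∈ (algebraMap (𝓞 ℚ) ℚ).range :=
    HeightOneSpectrum.mem_integers_of_valuation_le_one ℚ (E.u : ℚ) hall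
  obtain ⟨y, hy⟩ := hu
  refine ⟨Rat.ringOfIntegersEquiv y, ?_, ((Rat.ringOfIntegersEquiv_apply_coe y).trans hy).symm⟩
  intro h0
  have : (E.u : ℚ) = 0 := by
    rw [← (Rat.ringOfIntegersEquiv_apply_coe y).trans hy, h0]; simp
  exact Units.ne_zero E.u this


/-! ## §3 The integral model `Y_D(V) = [0, D b₂, 0, 8D² b₄, 16D³ b₆]` of `V^{(D)}` (scaling `u = 1/2`) -/

/-- The scaling `u = 1/2` carries the tree's twist `V^{(D)} = [0, D b₂/4, 0, D² b₄/2, D³ b₆/4]` to the INTEGRAL model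
`Y_D(V) = [0, D b₂, 0, 8D² b₄, 16D³ b₆]`. [cite: SilvermanAEC2009, III.1 Table 3.1] -/
theorem half_smul_quadraticTwist_eq (V : WeierstrassCurve ℚ) (D : ℚ) :
    (⟨Units.mk0 (1 / 2 : ℚ) (by norm_num), 0, 0, 0⟩ : VariableChange ℚ) • V.quadraticTwist D =
      ⟨0, D * V.b₂, 0, 8 * D ^ 2 * V.b₄, 16 * D ^ 3 * V.b₆⟩ := by
  ext
  · simp [variableChange_a₁]
  · simp [variableChange_a₂]; ring
  · simp [variableChange_a₃]
  · simp [variableChange_a₄]; ring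
  · simp [variableChange_a₆]; ring

/-- `Y_D(V)` is integral at every finite place when `V` is (`b₂, b₄, b₆ ∈ ℤ`). [cite: SilvermanAEC2009, III.1 and VIII.8] -/
theorem isIntegralAt_half_smul_quadraticTwist (V : WeierstrassCurve ℚ) [hV : V.IsIntegral (𝓞 ℚ)] (D : ℤ)
    (v : HeightOneSpectrum (𝓞 ℚ)) :
    (⟨0, (D : ℚ) * V.b₂, 0, 8 * (D : ℚ) ^ 2 * V.b₄, 16 * (D : ℚ) ^ 3 * V.b₆⟩ : WeierstrassCurve ℚ).IsIntegralAt v := by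
  obtain ⟨V₀, hV₀⟩ := hV.integral
  have hle : ∀ r : 𝓞 ℚ, v.valuation ℚ (algebraMap (𝓞 ℚ) ℚ r) ≤ 1 := fun r => v.valuation_le_one r
  have hb₂ : V.b₂ = algebraMap (𝓞 ℚ) ℚ V₀.b₂ := by rw [hV₀, WeierstrassCurve.baseChange, map_b₂]
  have hb₄ : V.b₄ = algebraMap (𝓞 ℚ) ℚ V₀.b₄ := by rw [hV₀, WeierstrassCurve.baseChange, map_b₄]
  have hb₆ : V.b₆ = algebraMap (𝓞 ℚ) ℚ V₀.b₆ := by rw [hV₀, WeierstrassCurve.baseChange, map_b₆]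
  refine (⟨0, (D : ℚ) * V.b₂, 0, 8 * (D : ℚ) ^ 2 * V.b₄, 16 * (D : ℚ) ^ 3 * V.b₆⟩ :
    WeierstrassCurve ℚ).isIntegralAt_of_valuation_le_one v ?_ ?_ ?_ ?_ ?_
  · simp
  · show v.valuation ℚ ((D : ℚ) * V.b₂) ≤ 1
    rw [hb₂, show ((D : ℚ) * algebraMap (𝓞 ℚ) ℚ V₀.b₂) = algebraMap (𝓞 ℚ) ℚ ((D : 𝓞 ℚ) * V₀.b₂) by simp]
    exact hle _
  · simp
  · show v.valuation ℚ (8 * (D : ℚ) ^ 2 * V.b₄) ≤ 1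
    rw [hb₄, show (8 * (D : ℚ) ^ 2 * algebraMap (𝓞 ℚ) ℚ V₀.b₄) =
      algebraMap (𝓞 ℚ) ℚ (8 * (D : 𝓞 ℚ) ^ 2 * V₀.b₄) by simp [map_ofNat]]
    exact hle _
  · show v.valuation ℚ (16 * (D : ℚ) ^ 3 * V.b₆) ≤ 1
    rw [hb₆, show (16 * (D : ℚ) ^ 3 * algebraMap (𝓞 ℚ) ℚ V₀.b₆) =
      algebraMap (𝓞 ℚ) ℚ (16 * (D : 𝓞 ℚ) ^ 3 * V₀.b₆) by simp [map_ofNat]]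
    exact hle _

/-! ## §4 Pal's `ũ` at a twist by `D ≡ 3 (mod 4)`: `|u(C)| = n/2` with `n ∈ ℤ ∖ {0}` for EVERY global minimal model -/

/-- **Pal's unit at a twist, lower bound form**: for `V` globally minimal, `D ≠ 0` and EVERY global minimal model
`W = C • V^{(D)}` of the twist, `|u(C)| = n/2` for some `n ∈ ℤ ∖ {0}` (`W = (C·C_{1/2}⁻¹) • Y_D(V)` with `Y_D(V)`
integral, so `2u(C) ∈ ℤ`). In particular `ord₂ |u| ≥ −1`. [cite: Pal2012, Prop. 2.5] [cite: SilvermanAEC2009, VII.1 Prop. 1.3] -/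
theorem exists_abs_u_eq_half_int (V : WeierstrassCurve ℚ) [V.IsElliptic] [V.IsGloballyMinimal] {D : ℤ} (hD : D ≠ 0)
    (W : WeierstrassCurve ℚ) [W.IsGloballyMinimal] (C : VariableChange ℚ)
    (hC : C • V.quadraticTwist (D : ℚ) = W) : ∃ n : ℤ, n ≠ 0 ∧ |(C.u : ℚ)| = (n.natAbs : ℚ) / 2 := by
  have hD0 : (D : ℚ) ≠ 0 := by exact_mod_cast hD
  haveI := V.isElliptic_quadraticTwist hD0
  set C₀ : VariableChange ℚ := ⟨Units.mk0 (1 / 2 : ℚ) (by norm_num), 0, 0, 0⟩ with hC₀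
  have hY := half_smul_quadraticTwist_eq V (D : ℚ)
  have hYΔ : (⟨0, (D : ℚ) * V.b₂, 0, 8 * (D : ℚ) ^ 2 * V.b₄, 16 * (D : ℚ) ^ 3 * V.b₆⟩ : WeierstrassCurve ℚ).Δ ≠ 0 := by
    rw [← hY, variableChange_Δ]
    exact mul_ne_zero (pow_ne_zero _ (Units.ne_zero _)) (by
      rw [← WeierstrassCurve.coe_Δ']; exact (V.quadraticTwist (D : ℚ)).Δ'.ne_zero)
  have hE : (C * C₀⁻¹) • (⟨0, (D : ℚ) * V.b₂, 0, 8 * (D : ℚ) ^ 2 * V.b₄, 16 * (D : ℚ) ^ 3 * V.b₆⟩ :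
      WeierstrassCurve ℚ) = W := by
    rw [← hY, mul_smul, inv_smul_smul, hC]
  obtain ⟨n, hn0, hn⟩ := exists_int_eq_u_of_isIntegralAt_of_isGloballyMinimal_smul hYΔ
    (isIntegralAt_half_smul_quadraticTwist V D) (C * C₀⁻¹) hE
  have hmul : ((C * C₀⁻¹).u : ℚ) = (C.u : ℚ) * 2 := by
    simp [VariableChange.mul_def, VariableChange.inv_def, hC₀]
  refine ⟨n, hn0, ?_⟩
  rw [show (C.u : ℚ) = n / 2 by rw [hmul] at hn; linarith, abs_div, Nat.cast_natAbs, Int.cast_abs]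
  norm_num

/-! ## §5 The real period of a global minimal model of the twist -/

/-- **The period of a global minimal model of the twist**: `Ω(W)·√|D| = (|n|/2)·c_∞(V)·Ω^{sgn D}(V)` with `n ∈ ℤ ∖ {0}`,
where `Ω^{sgn D} = periodSgn V D` (`Ω⁺(V)` for `D > 0`, `|Ω⁻(V)|` for `D < 0`), from Pal 2012 Thm. 3.2 (tree, both signs:
`realPeriodRat_mul_sqrt_of_twist_of_pos/_of_neg`), `c_∞(W) = c_∞(V)` (`Δ(W) = u⁻¹²D⁶Δ(V)`) and `Ω(V) = c_∞(V)·Ω⁺(V)`.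
[cite: Pal2012, Thm. 3.2] [cite: AdachiNomotoShii2026, §2 (the periods Ω_f^±)] -/
theorem realPeriodRat_twist_mul_sqrt (V : WeierstrassCurve ℚ) [V.IsElliptic] [V.IsGloballyMinimal] {D : ℤ}
    (hD : D ≠ 0) (W : WeierstrassCurve ℚ) [W.IsGloballyMinimal] (C : VariableChange ℚ)
    (hC : C • V.quadraticTwist (D : ℚ) = W) :
    ∃ n : ℤ, n ≠ 0 ∧ W.realPeriodRat * Real.sqrt (D.natAbs : ℝ) =
      (n.natAbs : ℝ) / 2 * (V.baseChange ℝ).numRealComponents * periodSgn V D := by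
  obtain ⟨n, hn0, hn⟩ := exists_abs_u_eq_half_int V hD W C hC
  refine ⟨n, hn0, ?_⟩
  have habs : |((C.u : ℚ) : ℝ)| = (n.natAbs : ℝ) / 2 := by
    rw [← Rat.cast_abs, hn]; push_cast; ring
  rcases lt_or_gt_of_ne hD with hneg | hpos
  · -- `D < 0`: Pal with `Ω⁻` and `c_∞(W) = c_∞(V)`
    have hDq : ((D : ℚ)) < 0 := by exact_mod_cast hneg
    have h := V.realPeriodRat_mul_sqrt_of_twist_of_neg hDq W C hC
    have hc : (W.baseChange ℝ).numRealComponents = (V.baseChange ℝ).numRealComponents := by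
      rw [numRealComponents_baseChange_real, numRealComponents_baseChange_real, ← hC, variableChange_Δ,
        quadraticTwist_Δ]
      have hu12 : (0 : ℚ) < ↑C.u⁻¹ ^ 12 := by
        rw [show (12 : ℕ) = 2 * 6 by rfl, pow_mul]
        exact pow_pos (lt_of_le_of_ne (sq_nonneg _) (Ne.symm (pow_ne_zero _ (Units.ne_zero _)))) 6
      have hd6 : (0 : ℚ) < (D : ℚ) ^ 6 := by
        rw [show (6 : ℕ) = 2 * 3 by rfl, pow_mul]
        exact pow_pos (lt_of_le_of_ne (sq_nonneg _) (Ne.symm (pow_ne_zero _ hDq.ne))) 3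
      simp only [mul_pos_iff_of_pos_left hu12, mul_pos_iff_of_pos_left hd6]
    have hsgn : periodSgn V D = V.imaginaryPeriodRat := by simp only [periodSgn, if_neg (not_lt.mpr hneg.le)]
    have habsD : ((D.natAbs : ℕ) : ℝ) = -((D : ℤ) : ℝ) := by
      rw [Nat.cast_natAbs, Int.cast_abs, abs_of_neg (by exact_mod_cast hneg)]
    rw [habsD, hsgn, ← hc, show (-((D : ℤ) : ℝ)) = -(((D : ℤ) : ℚ) : ℝ) by push_cast; ring, h, habs]
  · -- `D > 0`: Pal with `Ω(V) = c_∞(V)·Ω⁺(V)`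
    have hDq : (0 : ℚ) < (D : ℚ) := by exact_mod_cast hpos
    have h := V.realPeriodRat_mul_sqrt_of_twist_of_pos hDq W C hC
    have hsgn : periodSgn V D = leastRealPeriod V := by simp only [periodSgn, if_pos hpos]
    have hc0 : ((V.baseChange ℝ).numRealComponents : ℝ) ≠ 0 := by
      rw [numRealComponents_baseChange_real]; split_ifs <;> norm_num
    have hΩV : V.realPeriodRat = (V.baseChange ℝ).numRealComponents * leastRealPeriod V := by
      rw [leastRealPeriod, mul_div_cancel₀ _ hc0]
    have habsD : ((D.natAbs : ℕ) : ℝ) = ((D : ℤ) : ℝ) := by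
      rw [Nat.cast_natAbs, Int.cast_abs, abs_of_pos (by exact_mod_cast hpos)]
    rw [habsD, hsgn, show (((D : ℤ) : ℝ)) = (((D : ℤ) : ℚ) : ℝ) by push_cast; ring, h, habs, hΩV]
    ring

/-! ## §6 The habitat of C3″ at every model of `V^{(D)}`, `V` good at `2`, `D ≡ 3 (mod 4)` square-free -/

/-- **HABITAT of C3″ at every model of `V^{(D)}`** — `V` globally minimal, GOOD at `2`, `ord₂ j(V) ≥ 0`, non-CM, `V[2]`
irreducible; `D ≡ 3 (mod 4)` square-free; `W` any global minimal model of `V^{(D)}`: `W` is ADDITIVE at `2` (not good: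
Barrios et al. 2025 Thm. 5.1 via the tree's `X7Twist.not_hasGoodReductionAtPrime_two_of_twist_of_ramifiedInQuadratic`; not
multiplicative since `ord₂ j(W) = ord₂ j(V) ≥ 0`, `EisensteinPrimes.padicValRat_j_neg_of_mult`), POTENTIALLY GOOD, NON-CM
(`j(W) = j(V)`, `hasCM_iff_j_mem_holds`) and `W[2]` is IRREDUCIBLE (`P2.irr_two_iff_of_twist`).
[cite: BarriosEtAl2025, Thm. 5.1] [cite: SilvermanAEC2009, VII.5 Prop. 5.1, III.1 Prop. 1.4(b), App. C §11] -/
theorem habitat_smul_twist_of_good_two (V : WeierstrassCurve ℚ) [V.IsElliptic] [V.IsGloballyMinimal]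
    (hgood : V.HasGoodReductionAtPrime 2) (hj : 0 ≤ padicValRat 2 V.j) (hcm : ¬ V.HasCM)
    (hirr : V.HasIrreducibleModPGaloisRep 2) {D : ℤ} (hsq : Squarefree D) (hD4 : D % 4 = 3)
    (W : WeierstrassCurve ℚ) [W.IsElliptic] [W.IsGloballyMinimal] (C : VariableChange ℚ)
    (hC : C • V.quadraticTwist (D : ℚ) = W) :
    Addv W 2 ∧ 0 ≤ padicValRat 2 W.j ∧ ¬ W.HasCM ∧ Irr W 2 := by
  have hD0 : (D : ℚ) ≠ 0 := by exact_mod_cast hsq.ne_zero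
  haveI := V.isElliptic_quadraticTwist hD0
  subst hC
  have hjW : (C • V.quadraticTwist (D : ℚ)).j = V.j := by rw [variableChange_j, j_quadraticTwist V hD0]
  have hC' : C⁻¹ • (C • V.quadraticTwist (D : ℚ)) = V.quadraticTwist (D : ℚ) := inv_smul_smul _ _
  have hng : ¬ (C • V.quadraticTwist (D : ℚ)).HasGoodReductionAtPrime 2 :=
    X7Twist.not_hasGoodReductionAtPrime_two_of_twist_of_ramifiedInQuadratic V _ hsq hC' (Or.inr ⟨rfl, by omega⟩) hgood
  have hnm : ¬ (C • V.quadraticTwist (D : ℚ)).HasMultiplicativeReductionAtPrime 2 := fun hm => by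
    have h := EisensteinPrimes.padicValRat_j_neg_of_mult _ 2 hm
    rw [hjW] at h
    exact absurd hj (not_le.mpr h)
  refine ⟨⟨hng, hnm⟩, by rw [hjW]; exact hj, fun hW => hcm ?_, (irr_two_iff_of_twist V hD0 ⟨C, rfl⟩).mp hirr⟩
  exact (WeierstrassCurve.hasCM_iff_j_mem_holds V).mpr
    (hjW ▸ (WeierstrassCurve.hasCM_iff_j_mem_holds (C • V.quadraticTwist (D : ℚ))).mp hW)

/-! ## §7 CORE: an exact twisted algebraic part of the right `2`-adic size gives the LOWER half at the twist -/

/-- **CORE: an exact twisted algebraic part of the right `2`-adic size gives the LOWER half of BSD₂ at the twist.**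
`V` globally minimal with `V[2]` irreducible, `D ≢ 1 (mod 4)`, `D ≠ 0`; `W` a global minimal model of `V^{(D)}`
(`C • V^{(D)} = W`); `x ≠ 0` rational with `L(W,1) = x·Ω^{sgn D}(V)/√(4|D|)` (Adachi–Nomoto–Shii's `IsAlgPart V W D x`,
Thm. 2.1) and `ord₂ x ≤ [Δ(V) > 0]`. Then `r_an(W) = 0` (modularity) and `MissingLowerBoundAt W 2`: by §5
`L(W,1)/Ω(W) = x/(|n|·c_∞(V))`; `Reg(W) = 1` (rank `0`, GZK); `#W(ℚ)_tors` is ODD (`W[2]` irreducible,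
`padicValNat_torsionOrder_eq_zero_of_irreducible`); hence `#Ш_an(W) = x·#tors²/(|n|·c_∞(V)·Tam(W))` with
`ord₂ #Ш_an(W) = ord₂ x − ord₂ n − ord₂ c_∞(V) − ord₂ Tam(W) ≤ 0 ≤ ord₂ #Ш(W)`. No reading, no instrument.
[cite: AdachiNomotoShii2026, Thm. 2.1] [cite: Pal2012, Thm. 3.2] [cite: Miller2011LMS, Def. 1.1] -/
theorem missingLowerBoundAt_two_of_twist_algPart (hmod : hasEntireLFunction_rat)
    (hGZK : rank_eq_analyticRank_of_analyticRank_le_one)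
    (V : WeierstrassCurve ℚ) [V.IsElliptic] [V.IsGloballyMinimal] (hirr : V.HasIrreducibleModPGaloisRep 2)
    {D : ℤ} (hD0 : D ≠ 0) (hD4 : D % 4 ≠ 1)
    (W : WeierstrassCurve ℚ) [W.IsElliptic] [W.IsGloballyMinimal] (C : VariableChange ℚ)
    (hC : C • V.quadraticTwist (D : ℚ) = W) (x : ℚ) (hx0 : x ≠ 0) (halg : IsAlgPart V W D x)
    (hvx : padicValRat 2 x ≤ if 0 < V.Δ then 1 else 0) :
    W.analyticRank = 0 ∧ MissingLowerBoundAt W 2 := by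
  haveI : Fact (Nat.Prime 2) := ⟨Nat.prime_two⟩
  have hDq : (D : ℚ) ≠ 0 := by exact_mod_cast hD0
  haveI := V.isElliptic_quadraticTwist hDq
  -- the period: `Ω(W)·√m = (|n|/2)·c_∞(V)·Ω^{sgn}(V)`, `n ≠ 0`
  obtain ⟨n, hn0, hΩ⟩ := realPeriodRat_twist_mul_sqrt V hD0 W C hC
  have hm0 : D.natAbs ≠ 0 := Int.natAbs_ne_zero.mpr hD0
  have hmpos : (0 : ℝ) < (D.natAbs : ℝ) := by exact_mod_cast Nat.pos_of_ne_zero hm0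
  have hsqrt0 : Real.sqrt (D.natAbs : ℝ) ≠ 0 := (Real.sqrt_pos.mpr hmpos).ne'
  have hnabs : (n.natAbs : ℝ) ≠ 0 := by exact_mod_cast Int.natAbs_ne_zero.mpr hn0
  have hc0 : ((V.baseChange ℝ).numRealComponents : ℝ) ≠ 0 := by
    rw [numRealComponents_baseChange_real]; split_ifs <;> norm_num
  -- `periodSgn V D > 0`
  have hP : 0 < periodSgn V D := by
    unfold periodSgn; split_ifs
    · exact div_pos V.realPeriodRat_pos_holds (by rw [numRealComponents_baseChange_real]; split_ifs <;> norm_num)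
    · exact V.imaginaryPeriodRat_pos
  -- `L(W,1) = x·Ω^{sgn}/(2√m)`
  have hM : twistCharConductor D = 4 * D.natAbs := twistCharConductor_of_mod_four_ne_one hD4
  have hsqrt4 : Real.sqrt ((4 * D.natAbs : ℕ) : ℝ) = 2 * Real.sqrt (D.natAbs : ℝ) := by
    push_cast
    rw [Real.sqrt_mul (by norm_num), show Real.sqrt (4 : ℝ) = 2 by
      rw [show (4 : ℝ) = 2 ^ 2 by norm_num, Real.sqrt_sq (by norm_num)]]
  have hL : W.entireLFunction 1 = (x : ℂ) * (periodSgn V D : ℂ) / (2 * (Real.sqrt (D.natAbs : ℝ) : ℂ)) := by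
    rw [halg, hM, hsqrt4]; push_cast; ring
  have hLne : W.entireLFunction 1 ≠ 0 := by
    rw [hL]
    exact div_ne_zero (mul_ne_zero (by exact_mod_cast hx0) (by exact_mod_cast hP.ne'))
      (mul_ne_zero two_ne_zero (by exact_mod_cast hsqrt0))
  have hr : W.analyticRank = 0 := (W.analyticRank_eq_zero_iff_holds (hmod W)).mpr hLne
  -- rank 0, `Reg = 1`, odd torsion
  have hrank : W.mordellWeilRank = 0 := by have := (hGZK W (by omega)).1; omega
  have hreg := W.regulator_eq_one_of_rank_zero hrank
  have hirrW : W.HasIrreducibleModPGaloisRep 2 := (irr_two_iff_of_twist V hDq ⟨C, hC⟩).mp hirr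
  have htors := padicValNat_torsionOrder_eq_zero_of_irreducible W 2 hirrW
  have ht0 := W.torsionOrder_pos_holds
  have hT0 : 0 < W.tamagawaProduct := W.tamagawaProduct_pos_holds
  -- `Ω(W) = |n|·c_∞·Ω^{sgn}/(2√m)`
  have hΩ' : W.realPeriodRat = (n.natAbs : ℝ) / 2 * (V.baseChange ℝ).numRealComponents * periodSgn V D /
      Real.sqrt (D.natAbs : ℝ) := by
    rw [← hΩ, mul_div_cancel_right₀ _ hsqrt0]
  refine ⟨hr, x * (W.torsionOrder : ℚ) ^ 2 / ((n.natAbs : ℚ) * (V.baseChange ℝ).numRealComponents * W.tamagawaProduct), ?_, ?_⟩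
  · -- `#Ш_an(W) = x·#tors²/(|n|·c_∞·Tam)`
    have hPC : ((periodSgn V D : ℝ) : ℂ) ≠ 0 := by exact_mod_cast hP.ne'
    have hsC : ((Real.sqrt (D.natAbs : ℝ) : ℝ) : ℂ) ≠ 0 := by exact_mod_cast hsqrt0
    have hnC : ((n.natAbs : ℕ) : ℂ) ≠ 0 := by exact_mod_cast Int.natAbs_ne_zero.mpr hn0
    have hcC : (((V.baseChange ℝ).numRealComponents : ℕ) : ℂ) ≠ 0 := by
      rw [numRealComponents_baseChange_real]; split_ifs <;> norm_num
    have hTC : ((W.tamagawaProduct : ℕ) : ℂ) ≠ 0 := by exact_mod_cast hT0.ne'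
    rw [shaAn_def, leadingLCoeff_eq_of_analyticRank_eq_zero _ hr, hL, hreg, hΩ']
    push_cast
    field_simp
  · -- valuations: `ord₂ = v(x) − v(n) − v(c_∞) − v(Tam) ≤ v(x) − v(c_∞) ≤ 0`
    have ht0' : (W.torsionOrder : ℚ) ≠ 0 := by exact_mod_cast ht0.ne'
    have hT0' : (W.tamagawaProduct : ℚ) ≠ 0 := by exact_mod_cast hT0.ne'
    have hn0' : (n.natAbs : ℚ) ≠ 0 := by exact_mod_cast Int.natAbs_ne_zero.mpr hn0
    have hc0' : ((V.baseChange ℝ).numRealComponents : ℚ) ≠ 0 := by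
      rw [numRealComponents_baseChange_real]; split_ifs <;> norm_num
    rw [padicValRat.div (mul_ne_zero hx0 (pow_ne_zero 2 ht0')) (mul_ne_zero (mul_ne_zero hn0' hc0') hT0'),
      padicValRat.mul hx0 (pow_ne_zero 2 ht0'), padicValRat.pow, padicValRat.mul (mul_ne_zero hn0' hc0') hT0',
      padicValRat.mul hn0' hc0', padicValRat.of_nat, padicValRat.of_nat, padicValRat.of_nat, padicValRat.of_nat,
      htors]
    have hcv : (padicValNat 2 (V.baseChange ℝ).numRealComponents : ℤ) = if 0 < V.Δ then 1 else 0 := by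
      rw [numRealComponents_baseChange_real]
      split_ifs
      · have : padicValNat 2 2 = 1 := padicValNat.self one_lt_two
        exact_mod_cast this
      · simp
    have h1 : (0 : ℤ) ≤ (padicValNat 2 W.shaOrder : ℤ) := Int.natCast_nonneg _
    have h2 : (0 : ℤ) ≤ (padicValNat 2 W.tamagawaProduct : ℤ) := Int.natCast_nonneg _
    have h3 : (0 : ℤ) ≤ (padicValNat 2 n.natAbs : ℤ) := Int.natCast_nonneg _
    rw [hcv]
    simp only [Nat.cast_zero, mul_zero, add_zero]
    split_ifs at hvx ⊢ <;> linarith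

end Summit.BirchSwinnertonDyer.BirchSwinnertonDyer.Theorems.AddPotGoodPrint

end
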